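import Literature.NumberTheory.EllipticCurves.Kato2004.IwasawaCohomology
import Literature.NumberTheory.EllipticCurves.CyclotomicZpExtensionLayerProofs
import HarnessLib

/-!
# Kato 2004 (Astérisque 295) §13.1 / Thm. 13.4 ("`Z` … generated by `(z_{p^n})_n`"): the `p`-power levels
# of an Euler system for `T_pW`, corestricted to the layers of the cyclotomic `ℤ_p`-tower, LIFT to ONE
# element of the pinned `𝐇¹_Γ(T_pW)` — assembly over two displayed corestriction hypotheses

Topic `NumberTheory/EllipticCurves`, sub-directory `Kato2004`.  Seat `bsd-potss-rkm` (prover, cell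
`bsd-potss`, item stmt-BirchSwinnertonDyer-19196 `ReducibleKatoMember`): step P1 (b)-(iii) of the seat's
realisation spec v3 — the PIN of Kato's zeta class inside the tree's `IwasawaH1Data` (p417943) from a
`Kato2004.ZetaBody`-type family (p425804 at Kato's member).

## What is here

* `levelToLayer W p hκ hp S n` — the corestriction `Cor : H¹(ℚ(μ_{p^{n+1}}), T_pW) → H¹(ℚ_n, T_pW)` from
  the Euler-system level `(cyclotomicLevelsRat p S).level (n+1) ∅ = Gal(ℚ̄/ℚ(μ_{p^{n+1}}))` to the layer
  `κ.layerSubgroup n = Gal(ℚ̄/ℚ_n)` of a cyclotomic `κ` (`p` odd), available because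
  `Gal(ℚ̄/ℚ(μ_{p^{n+1}})) ≤ Gal(ℚ̄/ℚ_n)` (`ZpExtension.IsCyclotomic.cyclotomicLevelsRat_level_succ_le_layerSubgroup`,
  file `CyclotomicZpExtensionLayerProofs`); a plumbing `def` (the tree's `coresLe`).
* `IwasawaH1Data.existsUnique_lift_of_isEulerSystem` — for an Euler system `z` on the levels of
  `cyclotomicLevelsRat p S` (`IsEulerSystem`, norm-compatible in the `p`-direction by `cores_p`), the
  family `y_n := Cor(z_{n+1, ∅}) ∈ H¹(ℚ_n, T_pW)` is norm-compatible along the tower and hence — GIVEN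
  the two displayed corestriction hypotheses below — defines a UNIQUE `𝐲 ∈ 𝐇¹_Γ(T_pW)` with
  `proj n 𝐲 = y_n` (`IwasawaH1Data.exists_unique_lift`).  This is Kato's sentence "let `Z` be the
  `Λ`-submodule of `𝐇¹(T)` generated by `(z_{p^n})_n`" [Thm. 13.4, p. 226] on the `Δ`-trivial component.

## The two displayed hypotheses (NOT proved here; both are textbook functoriality of corestriction)

* `hcomp` — TRANSITIVITY of corestriction on the triples `Gal(ℚ̄/ℚ(μ_{p^{n+2}})) ≤ Gal(ℚ̄/ℚ_{n+1}) ≤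
  Gal(ℚ̄/ℚ_n)` versus `… ≤ Gal(ℚ̄/ℚ(μ_{p^{n+1}})) ≤ Gal(ℚ̄/ℚ_n)`: `Cor_{ℚ_{n+1}/ℚ_n} ∘ Cor_{ℚ(μ_{p^{n+2}})/ℚ_{n+1}}
  = Cor_{ℚ(μ_{p^{n+1}})/ℚ_n} ∘ Cor_{ℚ(μ_{p^{n+2}})/ℚ(μ_{p^{n+1}})}` (Neukirch–Schmidt–Wingberg, *Cohomology
  of Number Fields*, Prop. 1.5.3 (iii) `cor ∘ cor = cor`; the tree's `coresLe` has no composition lemma yet).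
* `hint` — INTEGRALITY is preserved by corestriction: `Cor(z_{n+1,∅}) ∈ H¹(ℤ_n[1/p], T_pW)` (`integralH1`),
  i.e. `Cor` maps `H¹(ℤ[ζ_{p^{n+1}}, 1/p], T) → H¹(ℤ_n[1/p], T)` (Kato §8.2: `H^q(R, T)` is étale cohomology
  of `Spec R`, functorial for the finite map `Spec ℤ[ζ_{p^{n+1}},1/p] → Spec ℤ_n[1/p]`; at class level a
  double-coset (Mackey) computation `res_{I_𝔓} ∘ cor = Σ cor ∘ c_σ ∘ res_{I_{σ𝔓}}`, not in the tree).
Nothing else is assumed; no named fact is minted; nothing about BSD is claimed.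

References: K. Kato, Astérisque 295 (2004) §12.2 (p. 220), §13.1 and Thm. 13.4 (pp. 224–226)
[Kato2004Asterisque]; J. Neukirch, A. Schmidt, K. Wingberg, *Cohomology of Number Fields*, 2nd ed.
(2008), Prop. 1.5.3 [NSW2008]; K. Rubin, *Euler Systems* (2000), Def. 2.1.1, App. B.2 [Rubin2000];
tree: `Kato2004/IwasawaCohomology.lean`, `CyclotomicZpExtensionLayerProofs.lean`,
`GaloisRepresentations/EulerSystem.lean` (`IsEulerSystem.cores_p`, `EulerSystemLevels.coresP`),
`GaloisRepresentations/ContinuousCorestriction.lean` (`coresLe`).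
-/

noncomputable section

open scoped NumberField
open Field IsDedekindDomain
open Literature.NumberTheory.GaloisRepresentations
open Literature.NumberTheory.EllipticCurves Literature.NumberTheory.EllipticCurves.Kato2004
open Literature.NumberTheory.EllipticCurves.Kato2004.EulerSystemValues

namespace Literature.NumberTheory.EllipticCurves.Kato2004

variable (W : WeierstrassCurve ℚ) [W.IsElliptic] (p : ℕ) [Fact p.Prime]
  [ContinuousSMul ℤ_[p] (W.tateModule p)] {κ : ZpExtension ℚ p} (hκ : κ.IsCyclotomic) (hp : p ≠ 2)

/-- **`Cor : H¹(ℚ(μ_{p^{n+1}}), T_pW) → H¹(ℚ_n, T_pW)`** — the corestriction from the Euler-system level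
`(cyclotomicLevelsRat p S).level (n+1) ∅` to the `n`-th layer of the cyclotomic `ℤ_p`-tower `κ` (`p` odd),
i.e. the tree's `coresLe` along `Gal(ℚ̄/ℚ(μ_{p^{n+1}})) ≤ Gal(ℚ̄/ℚ_n)`. Plumbing definition. [folklore] -/
def levelToLayer (S : Set (HeightOneSpectrum (𝓞 ℚ))) (n : ℕ) :
    H1 (tateRep W p) ((cyclotomicLevelsRat p S).level (n + 1) ∅) →ₗ[ℤ_[p]]
      H1 (tateRep W p) (κ.layerSubgroup n) :=
  haveI : ((cyclotomicLevelsRat p S).level (n + 1) ∅).FiniteIndex :=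
    finiteIndex_of_isOpen_of_compactSpace _ ((cyclotomicLevelsRat p S).isOpen_level (n + 1) ∅)
  haveI : Fintype (κ.layerSubgroup n ⧸
      ((cyclotomicLevelsRat p S).level (n + 1) ∅).subgroupOf (κ.layerSubgroup n)) :=
    Fintype.ofFinite _
  coresLe (tateRep W p).toTopRep (hκ.cyclotomicLevelsRat_level_succ_le_layerSubgroup hp S n)
    ((cyclotomicLevelsRat p S).isOpen_level (n + 1) ∅)

variable {γ : absoluteGaloisGroup ℚ} (I : IwasawaH1Data W p κ γ)

/-- **The Λ-adic class of the `p`-power levels of an Euler system (Kato §13.1 / Thm. 13.4, "`Z` …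
generated by `(z_{p^n})_n`"), assembled.**  Let `z` be an Euler system for `T_pW` on the levels of
`cyclotomicLevelsRat p S` and put `y_n := Cor_{ℚ(μ_{p^{n+1}})/ℚ_n}(z_{n+1,∅}) ∈ H¹(ℚ_n, T_pW)`.  GRANTED
(displayed, not proved here) the transitivity of corestriction on the relevant triples (`hcomp`) and the
integrality of the corestricted classes (`hint`), the family `(y_n)_n` is norm-compatible and integral
(`IsNormCompatible`; the `p`-direction relation `IsEulerSystem.cores_p` has NO Euler factor), hence there is
a UNIQUE `𝐲 ∈ 𝐇¹_Γ(T_pW)` (the pinned `IwasawaH1Data`) with `proj n 𝐲 = y_n` for every `n`.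
[cite: Kato2004Asterisque, §13.1 and Thm. 13.4 (pp. 224–226), §12.2 (p. 220)] -/
theorem IwasawaH1Data.existsUnique_lift_of_isEulerSystem
    [Module.Free ℤ_[p] (W.tateModule p)] [Module.Finite ℤ_[p] (W.tateModule p)]
    (S : Set (HeightOneSpectrum (𝓞 ℚ)))
    (z : ∀ (k : ℕ) (r : (cyclotomicLevelsRat p S).Ideals),
      H1 (tateRep W p) ((cyclotomicLevelsRat p S).level k r.1))
    (hz : IsEulerSystem (cyclotomicLevelsRat p S) (tateRep W p) p z)
    (hcomp : ∀ (n : ℕ) (x : H1 (tateRep W p) ((cyclotomicLevelsRat p S).level (n + 2) ∅)),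
      layerCores (tateRep W p) κ n (levelToLayer W p hκ hp S (n + 1) x) =
        levelToLayer W p hκ hp S n
          ((cyclotomicLevelsRat p S).coresP (tateRep W p) (Nat.le_succ (n + 1)) ∅ x))
    (hint : ∀ n : ℕ, levelToLayer W p hκ hp S n (z (n + 1) (cyclotomicLevelsRat p S).idealOne) ∈
      integralH1 (tateRep W p) p (κ.layerSubgroup n)) :
    ∃! y : I.H, ∀ n : ℕ,
      I.proj n y = levelToLayer W p hκ hp S n (z (n + 1) (cyclotomicLevelsRat p S).idealOne) := by
  refine I.exists_unique_lift ⟨hint, fun n ↦ ?_⟩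
  -- norm compatibility along the tower: transitivity of `Cor` + the `p`-direction Euler-system relation
  rw [hcomp n]
  congr 1
  exact hz.cores_p (Nat.le_succ (n + 1)) (cyclotomicLevelsRat p S).idealOne

end Literature.NumberTheory.EllipticCurves.Kato2004

end
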